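import Summits.CriticalPhenomena.CardyFormulaZ2.Theorems.CardyComplexConeDefs
import Summits.CriticalPhenomena.CardyFormulaZ2.Theorems.CardyComplexConeEdgePrecompactMedialExplorationShiftData
import Literature.Probability.Percolation.BondPercolationSymmetry
import Literature.Probability.LatticeModels.MedialWindingBridge

/-!
# Stub `stub_translationCovariance` of line `qkz-strip-boundary-arm`
(crux `EdgePrecompact`, stmt-CriticalPhenomena-11387)

Exact translation covariance of the corner observable: translating the corner `(v, f)` by a
lattice vector `w` is the same as translating the Dobrushin data,
`cornerObs (shiftData E w) δ (v + w) (f + w) = cornerObs E δ v f`, for ALL data `E`, reading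
meshes `δ` and corners (no admissibility needed: without a unique exploration of `E` there is none
of the shifted data either, and both sides are `0`).

Proof. Let `τ = sym2Equiv (Site.shift w)` (`s(x, y) ↦ s(x + w, y + w)`) and
`T = BondConfig.relabel τ` (`ω ↦ τ '' ω`, a measurable equivalence of bond configurations).
1. Measure: `P_{1/2}` on `ℤ²` is `T`-invariant (`bondPercolation_map_shift`, Grimmett 1999 §1.6), so
   the left-hand side is `∫ F' ∂P = ∫ F' ∂(P.map T) = ∫ F' ∘ T ∂P` (`integral_map_equiv`, no
   measurability needed).
2. Pointwise, `F' (T ω) = F ω`: the exploration of the shifted data in the shifted configuration is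
   the shifted exploration (`medialExploration_shiftData`, registered sub-goal of this line, module
   `CardyComplexConeEdgePrecompactMedialExplorationShiftData`), the shifted corner has source/target
   `τ (cornerSource v f)`, `τ (cornerTarget v f)` (`cornerSource_add`, `cornerTarget_add`, same
   module), `τ` is injective (so the passage conditions agree, `option_map_eq_some_apply_iff`), the
   medial points move rigidly by `meshPoint δ w` (`medialPoint_shift`) and the polyline winding is
   translation invariant (`winding_map_add_const`).
-/

namespace Summit.CriticalPhenomena.CardyFormulaZ2.Cruxes.EdgePrecompact.QkzStripBoundaryArm

open MeasureTheory Filter Set Metric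
open scoped Topology BigOperators Pointwise
open Literature.Probability.LatticeModels Literature.Probability.Percolation
open Literature.Probability.RandomPlanarGeometry (DobrushinDomain)
open Summit.CriticalPhenomena.CardyFormulaZ2.Theses.CardyComplexCone

/-! ## Translations move medial points rigidly and leave windings unchanged -/

/-- The medial point of a translated medial vertex is the translated medial point:
`medialPoint δ (τ e) = medialPoint δ e + δw`. -/
theorem medialPoint_shift (δ : ℝ) (w : Site 2) (e : MedialVertex) :
    medialPoint δ (sym2Equiv (Site.shift w) e) = medialPoint δ e + meshPoint δ w := by
  induction e using Sym2.ind with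
  | h x y =>
    rw [sym2Equiv_mk, Site.shift_apply, Site.shift_apply, medialPoint_mk, medialPoint_mk,
      meshPoint_add_shift, meshPoint_add_shift]
    ring

/-- The turning angle is translation invariant. -/
theorem turning_add_const (z₁ z₂ z₃ c : ℂ) :
    Polyline.turning (z₁ + c) (z₂ + c) (z₃ + c) = Polyline.turning z₁ z₂ z₃ := by
  simp [Polyline.turning]

/-- The polyline winding is translation invariant (Smirnov 2010, §2.2: the winding is the total
turning of the tangent). -/
theorem winding_map_add_const (c : ℂ) : ∀ l : List ℂ,
    Polyline.winding (l.map (· + c)) = Polyline.winding l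
  | [] => rfl
  | [_] => rfl
  | [_, _] => rfl
  | z₁ :: z₂ :: z₃ :: zs => by
    have ih := winding_map_add_const c (z₂ :: z₃ :: zs)
    simp only [List.map_cons] at ih ⊢
    rw [Polyline.winding_cons_cons_cons, Polyline.winding_cons_cons_cons, ih, turning_add_const]

/-- The winding read along (a prefix of) a translated medial path equals the winding along the
path. -/
theorem winding_take_map_shift (δ : ℝ) (w : Site 2) (γ : List MedialVertex) (n : ℕ) :
    Polyline.winding (((γ.map (sym2Equiv (Site.shift w))).map (medialPoint δ)).take n) =
      Polyline.winding ((γ.map (medialPoint δ)).take n) := by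
  rw [List.map_map, show medialPoint δ ∘ (sym2Equiv (Site.shift w)) =
      (· + meshPoint δ w) ∘ medialPoint δ from funext (medialPoint_shift δ w), ← List.map_map,
    ← List.map_take, winding_map_add_const]

/-- An injective map `g` reflects `Option.map g o = some (g a)` to `o = some a`. -/
theorem option_map_eq_some_apply_iff {α β : Type*} {g : α → β} (hg : Function.Injective g)
    (o : Option α) (a : α) : o.map g = some (g a) ↔ o = some a := by
  rw [← Option.map_some (f := g) (a := a)]
  exact (Option.map_injective hg).eq_iff

/-! ## The stub -/

/-- **`stub_translationCovariance`** (exact covariance, clause (ii-a) of the line). Translating the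
corner by a lattice vector `w` is the same as translating the Dobrushin data:
`cornerObs (shiftData E w) δ (v+w) (f+w) = cornerObs E δ v f` for ALL data `E`, meshes `δ` and corners
`(v, f)`. Measure step: translation invariance of `P_{1/2}` (`bondPercolation_map_shift`,
`integral_map_equiv`); pointwise step: `medialExploration_shiftData` and rigid transport of the
integrand. -/
theorem stub_translationCovariance : ∀ (E : DiscreteDobrushin) (δ : ℝ) (w v f : Site 2), IsCorner v f →
    cornerObs (shiftData E w) δ (v + w) (f + w) = cornerObs E δ v f := by
  intro E δ w v f _hvf
  unfold cornerObs
  conv_lhs => rw [← bondPercolation_map_shift w half]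
  rw [integral_map_equiv]
  refine integral_congr_ae (Eventually.of_forall fun ω => ?_)
  simp only []
  rw [medialExploration_shiftData E w ω]
  -- buildfix 2026-08-20: `cornerObs` (CardyComplexConeDefs, rebuilt) now unfolds to `FermionicObservable`'s
  -- `winding`; bridge it to the `Polyline` copy this file's lemmas are stated for (one constant after the
  -- pending Literature dedupe, when the bridge lemma becomes `rfl`).
  simp only [List.length_map, List.getElem?_map, cornerSource_add, cornerTarget_add,
    option_map_eq_some_apply_iff (sym2Equiv (Site.shift w)).injective,
    ← Literature.Probability.LatticeModels.Polyline.winding_eq_winding', winding_take_map_shift]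

end Summit.CriticalPhenomena.CardyFormulaZ2.Cruxes.EdgePrecompact.QkzStripBoundaryArm
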